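import Summits.AtomisticToContinuum.HydrodynamicLimit.Theses.JParityClosure
import Summits.AtomisticToContinuum.HydrodynamicLimit.Theses.InformationPercolationEngine

/-!
# Crux `LocalSecondLaw` (stmt-AtomisticToContinuum-13081) — redirect strategist r1, kernel-checked companion

Seat `planner-cstrat-stmt-AtomisticToContinuum-13081-r1-0` (2026-08-17), second-opinion census on the BLOCKED route
`route-AtomisticToContinuum-InformationPercolationEngine` (census `Cruxes/LocalSecondLaw/STRATEGY-CENSUS.md`, Part R1).
Imports only the two route files (the two route copies of the decl are one proposition, `jParity_iff_ipe`).

What this file certifies, for the tribunal (docs/architecture/tribunal.md §5 T1 / §15):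

* `CoarseHTheorem` — **the H-theorem between two positive times for the deterministic hard-sphere gas at fixed reduced
  density**, typed over the tree's vocabulary: for local-Gibbs data whose profile admits SOME classical hard-sphere-Euler
  development on SOME interval `[0,T)`, `T > 0` (an idle regularity certificate of the data — it is the only place the
  macroscopic PDE enters, and it enters existentially), for EVERY horizon `τ > 0` and every smooth bump `ψ ≥ 0` with
  `ψ 0 = 0` vanishing before `τ`, the event `∫₀^τ ψ′(s) · [∫_{𝕋³} H(U_r(s,x)) dx] ds < −η` (the `r`-coarse-grained
  hard-sphere entropy `−∫H(U_r)` is LARGER on the rising flank of `ψ` than on its falling flank by `η`, i.e. it DECREASED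
  between two positive times) has local-Gibbs probability `≤ δ` for `r < r₀`, `N ≥ N₀`.  No Euler field, no `T`, no `t = 0`
  datum occurs in the conclusion.
* `coarseHTheorem_of_localSecondLaw` — **the filed crux implies it** (instantiate the crux's space–time test function at
  `φ(s,x) := ψ(s)`: the convective term `(m_r/ρ_r)·∇φ` vanishes identically, `partialDeriv_constFun`, and the `t = 0` term
  `∫H(ρ₀,θ₀)φ(0)` vanishes because `ψ 0 = 0`).  Hence ANY proof of the crux as typed proves, in particular, two-time
  monotonicity of the coarse-grained entropy of a deterministic many-body system at positive density on macroscopic times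
  — for which no theorem is landed or in print (census Part R1 §R0, Part A §A0.1 (I1)–(I4)), while the summit
  `HydrodynamicLimit` (conclusion `∀ t ∈ Ico 0 T`) is silent at every `τ` beyond the classical lifespan and its collisionless
  analogue is TRUE where the analogue of `CoarseHTheorem` is FALSE (`Cruxes/LocalSecondLaw/NegativeNote-ideal-gas-dip.md`,
  replicated in Part R1 §N-R1-2).
* `coarseHTheorem_of_jParity` — the same over the JParityClosure copy.

No `sorry`; standard axioms only.  Nothing here is an obligation or a line.
-/

namespace Summit.AtomisticToContinuum.HydrodynamicLimit.Cruxes.LocalSecondLaw.StrategyCensusR1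

open scoped ContDiff
open MeasureTheory
open Summit.AtomisticToContinuum.HydrodynamicLimit.Theses
open Literature.MathematicalPhysics.KineticTheory

/-- A space-constant function on the torus has vanishing partial derivatives (the torus partial derivative is the
derivative at `0` of `t ↦ f (x + proj (t • eₖ))`, here a constant). -/
theorem partialDeriv_constFun (k : Fin 3) (c : ℝ) (x : T3) :
    Literature.Analysis.FunctionSpaces.Torus.partialDeriv k (fun _ : T3 => c) x = 0 := by
  simp [Literature.Analysis.FunctionSpaces.Torus.partialDeriv, Literature.Analysis.FunctionSpaces.Torus.lineDeriv]

/-- A time-only test function `φ(s,x) := ψ(s)` with `ψ` smooth is jointly smooth in space–time in the tree's sense. -/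
theorem isSmoothSpaceTimeOn_timeOnly {ψ : ℝ → ℝ} (hψ : ContDiff ℝ ∞ ψ) :
    Literature.Analysis.FunctionSpaces.Torus.IsSmoothSpaceTimeOn Set.univ (fun (s : ℝ) (_ : T3) => ψ s) := by
  unfold Literature.Analysis.FunctionSpaces.Torus.IsSmoothSpaceTimeOn
  exact (hψ.comp contDiff_fst).contDiffOn

/-- **CoarseHTheorem — the H-theorem between positive times for deterministic hard spheres at fixed reduced density.**
Same profiles / `σ₀` / flow family / mollifier / empirical fields / hard-sphere entropy density `Hs` as the filed crux
`Theses.InformationPercolationEngine.LocalSecondLaw`; the classical Euler development appears ONLY as the existential data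
certificate `∃ T ρ θ u, 0 < T ∧ IsHardSphereEulerSolution σ T ρ u θ ∧ TendstoHydroFieldsAt … 0`; the conclusion is the
in-probability weak monotonicity of `s ↦ −∫ Hs(ρ_r, θ_r)(s, x) dx` on `(0, τ)` for EVERY `τ > 0`, tested against smooth
bumps `ψ ≥ 0`, `ψ 0 = 0`, `ψ = 0` on `[τ', ∞)` for some `τ' < τ`. -/
def CoarseHTheorem : Prop :=
  ∀ (a₀ θ₀ : Literature.MathematicalPhysics.KineticTheory.T3 → ℝ) (u₀ : Literature.MathematicalPhysics.KineticTheory.T3 → Literature.MathematicalPhysics.KineticTheory.V3), Continuous a₀ → Continuous θ₀ → Continuous u₀ → (∀ x, 0 < a₀ x) → (∀ x, 0 < θ₀ x) → ∃ σ₀ : ℝ, 0 < σ₀ ∧ ∀ σ : ℝ, 0 < σ → σ < σ₀ → ∀ Φ : (N : ℕ) → Literature.Analysis.FluidPDE.HardSphereFlow (Literature.Analysis.FluidPDE.Torus.geometry (Fin 3)) (Literature.MathematicalPhysics.KineticTheory.hsDiameter σ N) (N + 1), (∃ (T : ℝ) (ρ θ : ℝ → Literature.MathematicalPhysics.KineticTheory.T3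 → ℝ) (u : ℝ → Literature.MathematicalPhysics.KineticTheory.T3 → Literature.MathematicalPhysics.KineticTheory.V3), 0 < T ∧ Literature.MathematicalPhysics.KineticTheory.IsHardSphereEulerSolution σ T ρ u θ ∧ Literature.MathematicalPhysics.KineticTheory.TendstoHydroFieldsAt (fun N => Literature.MathematicalPhysics.KineticTheory.localGibbsLaw σ a₀ u₀ θ₀ N (Φ N)) Φ ρ u θ 0) → ∀ τ : ℝ, 0 < τ → ∀ ψ : ℝ → ℝ, ContDiff ℝ ∞ ψ → (∀ s, 0 ≤ ψ s) → ψ 0 = 0 → (∃ τ' : ℝ, τ' < τ ∧ ∀ s, τ' ≤ s → ψ s = 0) → ∀ η δ : ℝ, 0 < η → 0 < δ → ∃ r₀ : ℝ, 0 < r₀ ∧ ∀ r : ℝ, 0 < r → r < r₀ → ∃ N₀ : ℕ, ∀ N : ℕ, N₀ ≤ N → let γ : Literature.Analysis.FluidPDE.Config (N + 1) (Fin 3) Literature.MathematicalPhysics.KineticTheory.T3 → ℝ → Literature.Analysis.FluidPDE.Config (N + 1) (Fin 3) Literature.MathematicalPhysics.KineticTheory.T3 := fun z s => (Φ N).flow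 s z; let bx : Literature.MathematicalPhysics.KineticTheory.T3 → Literature.MathematicalPhysics.KineticTheory.T3 → ℝ := fun x y => 3 / (Real.pi * r ^ 3) * max (1 - Literature.Analysis.FluidPDE.Torus.euclidDist x y / r) 0; let ρm : Literature.Analysis.FluidPDE.Config (N + 1) (Fin 3) Literature.MathematicalPhysics.KineticTheory.T3 → ℝ → Literature.MathematicalPhysics.KineticTheory.T3 → ℝ := fun z s x₀ => ∫ q, bx q.1 x₀ ∂(Literature.Analysis.FluidPDE.empiricalMeasure (γ z s)); let mm : Literature.Analysis.FluidPDE.Config (N + 1) (Fin 3) Literature.MathematicalPhysics.KineticTheory.T3 → ℝ → Literature.MathematicalPhysics.KineticTheory.T3 → Literature.MathematicalPhysics.KineticTheory.V3 := fun z s x₀ => ∫ q, bx q.1 x₀ • q.2 ∂(Literature.Analysis.FluidPDE.empiricalMeasure (γ z s)); let em : Literature.Analysis.FluidPDE.Config (N + 1) (Fin 3) Literature.MathematicalPhysics.KineticTheory.T3 → ℝ → Literature.MathematicalPhysics.KineticTheory.T3 → ℝ := fun z s x₀ => ∫ q, bx q.1 x₀ * (‖q.2‖ ^ 2 / 2)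 ∂(Literature.Analysis.FluidPDE.empiricalMeasure (γ z s)); let θm : Literature.Analysis.FluidPDE.Config (N + 1) (Fin 3) Literature.MathematicalPhysics.KineticTheory.T3 → ℝ → Literature.MathematicalPhysics.KineticTheory.T3 → ℝ := fun z s x₀ => 2 / 3 * (em z s x₀ / ρm z s x₀ - ‖mm z s x₀‖ ^ 2 / (2 * ρm z s x₀ ^ 2)); let Hs : ℝ → ℝ → ℝ := fun a b => if 0 < a ∧ 0 < b then -(a * (3 / 2 * Real.log b - Real.log a - Literature.MathematicalPhysics.KineticTheory.hsExcessFreeEnergy (a * σ ^ 3))) else 0; Literature.MathematicalPhysics.KineticTheory.localGibbsLaw σ a₀ u₀ θ₀ N (Φ N) {z | (∫ s in Set.Icc (0 : ℝ) τ, ∫ x : Literature.MathematicalPhysics.KineticTheory.T3, Hs (ρm z s x) (θm z s x) * deriv ψ s) < -η} ≤ ENNReal.ofReal δ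

/-- **The filed crux implies the H-theorem between positive times.**  Test the crux with the time-only bump
`φ(s,x) := ψ(s)`: the convective term dies by `partialDeriv_constFun`, the initial term by `ψ 0 = 0`. -/
theorem coarseHTheorem_of_localSecondLaw (h : InformationPercolationEngine.LocalSecondLaw) : CoarseHTheorem := by
  intro a₀ θ₀ u₀ ha hθ hu ha0 hθ0
  obtain ⟨σ₀, hσ₀, H⟩ := h a₀ θ₀ u₀ ha hθ hu ha0 hθ0
  refine ⟨σ₀, hσ₀, fun σ hσ hσ' Φ hdata τ hτ ψ hψ hψ0 hψz hsupp η δ hη hδ => ?_⟩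
  obtain ⟨T, ρ, θ, u, hT, hE, h0⟩ := hdata
  obtain ⟨τ', hτ', hτ'0⟩ := hsupp
  obtain ⟨r₀, hr₀, Hr⟩ := H σ hσ hσ' T ρ θ u hE Φ h0 hT τ hτ (fun s _ => ψ s) (isSmoothSpaceTimeOn_timeOnly hψ)
    (fun s _ => hψ0 s) ⟨τ', hτ', fun s hs _ => hτ'0 s hs⟩ η δ hη hδ
  refine ⟨r₀, hr₀, fun r hr hrr => ?_⟩
  obtain ⟨N₀, HN⟩ := Hr r hr hrr
  refine ⟨N₀, fun N hN => ?_⟩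
  have key := HN N hN
  simp only [partialDeriv_constFun, mul_zero, Finset.sum_const_zero, add_zero, hψz, integral_zero] at key
  simpa using key

/-- The same over the JParityClosure copy of the decl (the two copies are one proposition). -/
theorem jParity_iff_ipe : JParityClosure.LocalSecondLaw ↔ InformationPercolationEngine.LocalSecondLaw := Iff.rfl

theorem coarseHTheorem_of_jParity (h : JParityClosure.LocalSecondLaw) : CoarseHTheorem :=
  coarseHTheorem_of_localSecondLaw (jParity_iff_ipe.mp h)

end Summit.AtomisticToContinuum.HydrodynamicLimit.Cruxes.LocalSecondLaw.StrategyCensusR1
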